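import Summits.QuantumFields.YangMills.Theorems.BalabanLadderUVOtherGroupsClasses
import Summits.QuantumFields.YangMills.Theorems.ConvexGribovBodyNonSimplyConnectedLatticeGapAdmissibleInstance
import Literature.LinearAlgebra.Matrix.SpecialUnitaryGroupNonisomorphism
import Literature.Barriers.SmoothPoincare4.ExoticOpenFourSpaceGaugeGroupProofs
import HarnessLib

/-!
# Route `BalabanLadder`, crux `UVOtherGroups` (stmt-QuantumFields-19356): the non-`SU(N)` class is INHABITED — `SO(3)`

Helper file (`--supports stmt-QuantumFields-19356`, fleet seat `ym-osasm-p2`, director-ym R136 (iii)); pure theorems.  The third class of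
the bridge's case split — compact simple `G` (`IsCompactSimpleLieGroup G`) admitting NO topological-group isomorphism `G ≃ₜ* SU(N)`, `N ≥ 2` —
carries the R85 edit's record residual `UVNonSUNRec` (and today's ∀-shape `UVNonSUN`).  This file certifies, in the tree's own typing, that
the class is NON-EMPTY: the rotation group `SO(3)` (tree `Literature.AlgebraicTopology.FundamentalGroup.SO3`, certified compact simple Lie by
`Theorems.NonSimplyConnectedLatticeGap.isCompactSimpleLieGroup_SO3`, route `ConvexGribovBody`) has TRIVIAL centre, while `Z(SU(N))` has
`N ≥ 2` elements (`Literature.LinearAlgebra.Matrix.natCard_center_specialUnitaryGroup`), so `SO(3) ≄ SU(N)` for every `N ≥ 2`.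

* §1 `Z(SO(3)) = 1` is the tree's `Literature.Barriers.SmoothPoincare4.SO3.center_eq_bot` (imported); `natCard_center_SO3`;
* §2 `isEmpty_so3_mulEquiv_sun`, `isEmpty_so3_continuousMulEquiv_sun` (`N ≥ 2`), `exists_admissible_nonSUN` — the third class is inhabited;
* §3 consequences for the leg: the residual pieces SPEAK ABOUT `SO(3)` lattice gauge theory (`ceilingsOfFloors_so3_of_uvNonSUN`,
  `ceilingsOfFloors_so3_of_uvOtherGroups`, `legsWitness_so3_of_nonSUNRec`) — they are not vacuous, and any refutation ∕ discharge of the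
  third piece may be attempted at `G = SO(3)` (physically: `SU(2)` Wilson theory in the ADJOINT representation modulo its blind centre).

HONEST FRAMING: structure only (non-vacuity of a hypothesis class); nothing of the leg is discharged; not a gap, not Clay.
Refs: Hatcher 2002 §3.D (`S³ → SO(3)`); Curtis 1984 VII §C Prop. 9 (centres of `SU(n)`).
-/

set_option autoImplicit false

noncomputable section

open MeasureTheory Filter Topology
open Literature.MathematicalPhysics.QuantumFieldTheory Literature.MathematicalPhysics.QuantumLattice
open Literature.AlgebraicTopology.FundamentalGroup (SO3)
open Summit.QuantumFields.YangMills.Theorems.NonSimplyConnectedLatticeGap (isCompactSimpleLieGroup_SO3 so3_isTopologicalGroup so3_compactSpace)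
open Summit.QuantumFields.YangMills.Cruxes.OSLegsFromFemtoAndGap.DlrCollarTransfer

namespace Summit.QuantumFields.YangMills.Theorems.UVOtherGroups

/-! ## §1 The centre of `SO(3)` is trivial (tree) -/

/- `Z(SO(3)) = 1` is the tree's `Literature.Barriers.SmoothPoincare4.SO3.center_eq_bot` (direct matrix computation; equivalently, via the
covering `rotHom : S³ →* SO(3)`: a lift of a central rotation has continuous commutator map `S³ → ker rotHom = {±1}`, constant on the
connected `S³`, so the lift is central in `S³`, i.e. `±1`).  Imported, not restated. -/

/-- `Z(SO(3))` has exactly one element. -/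
theorem natCard_center_SO3 : Nat.card (Subgroup.center SO3) = 1 := by
  rw [Literature.Barriers.SmoothPoincare4.SO3.center_eq_bot]
  exact Nat.card_unique

/-! ## §2 `SO(3)` lies in the non-`SU(N)` class; the class is inhabited -/

/-- **`SO(3) ≄ SU(N)` as groups for every `N ≥ 2`**: the centres have `1` and `N` elements (`natCard_center_SO3`,
`Literature.LinearAlgebra.Matrix.natCard_center_specialUnitaryGroup`), and a group isomorphism matches centres (`Subgroup.centerCongr`). -/
theorem isEmpty_so3_mulEquiv_sun {N : ℕ} (hN : 2 ≤ N) : IsEmpty (SO3 ≃* Matrix.specialUnitaryGroup (Fin N) ℂ) := by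
  haveI : Nonempty (Fin N) := ⟨⟨0, by omega⟩⟩
  refine ⟨fun e => ?_⟩
  have h := Nat.card_congr (Subgroup.centerCongr e).toEquiv
  rw [natCard_center_SO3, Literature.LinearAlgebra.Matrix.natCard_center_specialUnitaryGroup, Fintype.card_fin] at h
  omega

/-- **No topological-group isomorphism `SO(3) ≃ₜ* SU(N)`, `N ≥ 2`.** -/
theorem isEmpty_so3_continuousMulEquiv_sun {N : ℕ} (hN : 2 ≤ N) : IsEmpty (SO3 ≃ₜ* Matrix.specialUnitaryGroup (Fin N) ℂ) :=
  ⟨fun e => (isEmpty_so3_mulEquiv_sun hN).false e.toMulEquiv⟩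

/-- **The non-`SU(N)` class of compact simple Lie groups is INHABITED** — by `SO(3)`: a compact simple Lie group in the bridge's sense
(`isCompactSimpleLieGroup_SO3`) admitting no `G ≃ₜ* SU(N)` for any `N ≥ 2`.  Hence the third residual piece of the R85 edit (`UVNonSUNRec`)
and today's `UVNonSUN` quantify over a non-empty class: neither is vacuously true. -/
theorem exists_admissible_nonSUN :
    ∃ (G : Type) (_ : Group G) (_ : TopologicalSpace G) (_ : IsTopologicalGroup G) (_ : CompactSpace G),
      IsCompactSimpleLieGroup G ∧ ∀ N : ℕ, 2 ≤ N → IsEmpty (G ≃ₜ* Matrix.specialUnitaryGroup (Fin N) ℂ) :=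
  ⟨SO3, inferInstance, inferInstance, so3_isTopologicalGroup, so3_compactSpace, isCompactSimpleLieGroup_SO3,
    fun _ hN => isEmpty_so3_continuousMulEquiv_sun hN⟩

/-! ## §3 The residual pieces speak about `SO(3)` lattice gauge theory -/

/-- **`UVNonSUN` at `SO(3)`**: the ∀-shape residual gives `CeilingsOfFloors SO(3)` (Borel σ-algebra; instances the landed theorems
`so3_isTopologicalGroup`, `so3_compactSpace`). -/
theorem ceilingsOfFloors_so3_of_uvNonSUN (h : UVNonSUN) :
    @CeilingsOfFloors SO3 _ _ so3_isTopologicalGroup so3_compactSpace (borel SO3) (@BorelSpace.mk SO3 _ (borel SO3) rfl) :=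
  @h SO3 _ _ so3_isTopologicalGroup so3_compactSpace isCompactSimpleLieGroup_SO3 fun _ hN => isEmpty_so3_continuousMulEquiv_sun hN

/-- **The leg `UVOtherGroups` at `SO(3)`** (its guard `IsEmpty (SO(3) ≃ₜ* SU(2))` holds): `CeilingsOfFloors SO(3)`. -/
theorem ceilingsOfFloors_so3_of_uvOtherGroups (h : Summit.QuantumFields.YangMills.Theses.BalabanLadder.UVOtherGroups) :
    @CeilingsOfFloors SO3 _ _ so3_isTopologicalGroup so3_compactSpace (borel SO3) (@BorelSpace.mk SO3 _ (borel SO3) rfl) :=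
  @h SO3 _ _ so3_isTopologicalGroup so3_compactSpace isCompactSimpleLieGroup_SO3 (isEmpty_so3_continuousMulEquiv_sun le_rfl)

/-- **The record residual at `SO(3)`**: the R85 piece (stated inline) yields SOME lattice representation of `SO(3)` and SOME positive unit
`a → 0` carrying floors ∧ ceilings of `SO(3)` lattice gauge theory. -/
theorem legsWitness_so3_of_nonSUNRec
    (h : ∀ (G : Type) [Group G] [TopologicalSpace G] [IsTopologicalGroup G] [CompactSpace G],
      IsCompactSimpleLieGroup G → (∀ N : ℕ, 2 ≤ N → IsEmpty (G ≃ₜ* Matrix.specialUnitaryGroup (Fin N) ℂ)) →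
      letI : MeasurableSpace G := borel G; haveI : BorelSpace G := ⟨rfl⟩;
      ∃ (r : LatticeRep G) (a : ℝ → ℝ), (∀ β, 0 < a β) ∧ Tendsto a atTop (𝓝 0) ∧ LowerBounds G r a ∧ MomentBounds6 G r a) :
    letI : MeasurableSpace SO3 := borel SO3; haveI : BorelSpace SO3 := ⟨rfl⟩;
    ∃ (r : LatticeRep SO3) (a : ℝ → ℝ), (∀ β, 0 < a β) ∧ Tendsto a atTop (𝓝 0) ∧
      @LowerBounds SO3 _ _ so3_isTopologicalGroup so3_compactSpace (borel SO3) ⟨rfl⟩ r a ∧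
      @MomentBounds6 SO3 _ _ so3_isTopologicalGroup so3_compactSpace (borel SO3) ⟨rfl⟩ r a :=
  @h SO3 _ _ so3_isTopologicalGroup so3_compactSpace isCompactSimpleLieGroup_SO3 fun _ hN => isEmpty_so3_continuousMulEquiv_sun hN

end Summit.QuantumFields.YangMills.Theorems.UVOtherGroups

end
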